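import Summits.QuantumFields.YangMills.Theses.ParabolicTrajectory
import Summits.QuantumFields.YangMills.Theorems.ParabolicTrajectoryLatticeGapOnTrajectoryStubTransferSymMain
import Summits.QuantumFields.YangMills.Theorems.ParabolicTrajectoryLatticeGapOnTrajectoryStubNegReflectRP

/-!
# Crux `LatticeGapOnTrajectory` (stmt-QuantumFields-10523) — restatement C2: the repair with BOTH
# typed defects removed, and the variant in which the transfer conjunct is a LANDED theorem
# (planner-facing; lead c2, 2026-08-16)

Five line leads (-0, -c1, -a1, -a2, -c2) and the drefuter concur that conjunct (B) AS FILED has a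
transfer clause underivable by any line, for two independent reasons now isolated as the two residual
stubs of the registered skeleton `Lines/line_orbit_kantorovich_finite_size.lean` (reshape 4b):
`stub_symmetrise` (α: arbitrary witness renormalisations `sch'`) and `stub_volume` (β: no physical
volume clause). This file gives the planner ELABORATED texts and the re-proved deciding theorem:

* `LatticeGapOnTrajectoryRV` — (B) with the volume hypothesis
  `Tendsto (fun k => sch.a k * sch.L k / Real.log (sch.a k)⁻¹) atTop atTop` ADDED and the transfer
  clause restricted to reflection-symmetric, polynomially bounded `sch'` (= `Restatement.lean`'s
  `LatticeGapOnTrajectoryR` + a2's volume clause; deletes exactly the two residual stubs).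
* `LatticeGapOnTrajectoryUSC` — a PURE LATTICE variant: same hypotheses ⇒ `∃ Δ > 0`,
  `HasLatticeMassGap r sch Δ` ∧ slab clustering in cluster-expansion format on the scheme's own tori
  (the conclusion of the registered `stub_slabClustering`, stated raw); `latticeGapOnTrajectoryRV_of_USC`:
  it implies `LatticeGapOnTrajectoryRV` by the LANDED `stub_transferSym` (here through its one-scheme core
  `Transfer.hasMassGap_of_slabClustering`) + `stub_negReflectRP`
  (kernel-checked: under this currency the transfer conjunct is a theorem of the tree).
* `TunedSequenceExistsV` — (S) that also outputs the volume clause (free: the tuner chooses `L_k`);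
  `tunedSequenceExists_of_V`.
* `ContinuumLimitOnTrajectoryR` — (A) outputting a reflection-symmetric, polynomially bounded `sch'`
  (as in `Restatement.lean`); `continuumLimitOnTrajectory_of_R`.
* `closesRV : ContinuumLimitOnTrajectoryR → LatticeGapOnTrajectoryRV → TunedSequenceExistsV → YangMills`.
* `latticeGapOnTrajectoryRV_of_filed` — RV is WEAKER than (B) as filed.

`lean check`: rc 0, 0 sorries.
-/

namespace Summit.QuantumFields.YangMills.Cruxes.LatticeGapOnTrajectory.RestatementC2

open scoped ComplexConjugate
open Filter Topology MeasureTheory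
open Literature.MathematicalPhysics.QuantumFieldTheory Literature.MathematicalPhysics.QuantumLattice
open Summit.QuantumFields.YangMills.Theses.ParabolicTrajectory
open Summit.QuantumFields.YangMills.Cruxes.LatticeGapOnTrajectory.OrbitKantorovichFiniteSize

/-- **(B) repaired, both defects removed: `LatticeGapOnTrajectoryRV`.** Verbatim the filed
`LatticeGapOnTrajectory` except: (β) the extra hypothesis that the physical volume outgrows the log of the
cutoff, and (α) the transfer clause quantifies over witness schemes `sch'` with the same `(a, β, L)` whose
renormalisations are time-reflection symmetric and polynomially bounded in the cutoff. -/
def LatticeGapOnTrajectoryRV : Prop :=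
  ∀ (G : Type) [Group G] [TopologicalSpace G] [IsTopologicalGroup G] [CompactSpace G],
    IsCompactSimpleLieGroup G → letI : MeasurableSpace G := borel G; haveI : BorelSpace G := ⟨rfl⟩;
    ∀ (r : LatticeRep G) (M : ℕ) (θ : ℝ) (sch : SpeciesScheme (YMSpecies G)) (n : ℕ → ℕ),
    2 ≤ M → 0 < θ → (∀ k, sch.a k = ((M : ℝ) ^ n k)⁻¹) → Filter.Tendsto sch.β Filter.atTop Filter.atTop →
    Filter.Tendsto (fun k => sch.a k * sch.L k / Real.log (sch.a k)⁻¹) Filter.atTop Filter.atTop →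
    Filter.Tendsto (fun k => ((M : ℝ) ^ n k) ^ 8 *
      latticeConnectedCorr r.ρ (sch.β k) (sch.side k) r.curvature.F r.curvature.F (M ^ n k))
      Filter.atTop (nhds θ) →
    ∃ Δ : ℝ, 0 < Δ ∧ HasLatticeMassGap r sch Δ ∧
      ∀ sch' : SpeciesScheme (YMSpecies G), sch'.a = sch.a → sch'.β = sch.β → sch'.L = sch.L →
        sch'.IsReflectionSymmetric →
        (∀ s, ∃ (q : ℕ) (K : ℝ), ∀ k,
          |sch'.c s k| ≤ K * ((sch'.a k)⁻¹) ^ q ∧ |sch'.m s k| ≤ K * ((sch'.a k)⁻¹) ^ q) →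
        ∀ T : OSData (YMSpecies G) 4, IsYangMillsFor r sch' T → T.HasMassGap Δ

/-- **(B) repaired as a PURE LATTICE statement: `LatticeGapOnTrajectoryUSC`.** Same hypotheses as
`LatticeGapOnTrajectoryRV`; conclusion: `∃ Δ > 0` with the per-pair sup-norm gap `HasLatticeMassGap r sch Δ`
(the summit's lattice clause) AND uniform slab clustering in cluster-expansion format on the scheme's own
tori (the registered `stub_slabClustering`'s conclusion, raw): for every bounded measurable observable `X`
of the links based at lattice times `1 … w` and every separation `N` with `N + 2w ≤ L_k`,
`‖osCorr μ_k Θ₀ τ_N X X‖ ≤ K (a_k⁻¹(w+1)(L_k+1))^p B² e^{−Δ a_k N}`. No transfer clause. -/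
def LatticeGapOnTrajectoryUSC : Prop :=
  ∀ (G : Type) [Group G] [TopologicalSpace G] [IsTopologicalGroup G] [CompactSpace G],
    IsCompactSimpleLieGroup G → letI : MeasurableSpace G := borel G; haveI : BorelSpace G := ⟨rfl⟩;
    ∀ (r : LatticeRep G) (M : ℕ) (θ : ℝ) (sch : SpeciesScheme (YMSpecies G)) (n : ℕ → ℕ),
    2 ≤ M → 0 < θ → (∀ k, sch.a k = ((M : ℝ) ^ n k)⁻¹) → Filter.Tendsto sch.β Filter.atTop Filter.atTop →
    Filter.Tendsto (fun k => sch.a k * sch.L k / Real.log (sch.a k)⁻¹) Filter.atTop Filter.atTop →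
    Filter.Tendsto (fun k => ((M : ℝ) ^ n k) ^ 8 *
      latticeConnectedCorr r.ρ (sch.β k) (sch.side k) r.curvature.F r.curvature.F (M ^ n k))
      Filter.atTop (nhds θ) →
    ∃ Δ : ℝ, 0 < Δ ∧ HasLatticeMassGap r sch Δ ∧
      ∃ (p : ℕ) (K : ℝ), 0 ≤ K ∧ ∀ᶠ k in Filter.atTop,
        ∀ (w N : ℕ) (X : GaugeConfig 4 (sch.side k) G → ℂ) (B : ℝ), Measurable X → (∀ U, ‖X U‖ ≤ B) →
          DependsOn X {e : Edge 4 (sch.side k) | 1 ≤ (e.1 0).val ∧ (e.1 0).val ≤ w} →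
          N + 2 * w ≤ sch.L k →
            ‖osCorr (wilsonMeasure r.ρ (sch.β k)) GaugeConfig.negReflect (torusTimeShift (sch.side k) N) X X‖ ≤
              K * ((sch.a k)⁻¹ * ((w : ℝ) + 1) * ((sch.L k : ℝ) + 1)) ^ p * B ^ 2 *
                Real.exp (-Δ * sch.a k * N)

/-- **Under the slab-clustering currency the transfer conjunct is a theorem of the tree**: the pure
lattice repaired crux implies the repaired crux with transfer, by the landed `stub_transferSym`
(Hankel route) fed with the landed `stub_negReflectRP` (site RP of the odd tori). -/
theorem latticeGapOnTrajectoryRV_of_USC (h : LatticeGapOnTrajectoryUSC) : LatticeGapOnTrajectoryRV := by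
  intro G _ _ _ _ hG r M θ sch n hM hθ hshape hβ hvol htune
  letI : MeasurableSpace G := borel G
  haveI : BorelSpace G := ⟨rfl⟩
  obtain ⟨Δ, hΔ, hgap, hclust⟩ := h G hG r M θ sch n hM hθ hshape hβ hvol htune
  refine ⟨Δ, hΔ, hgap, ?_⟩
  -- = the landed `stub_transferSym` (p121787), inlined through its one-scheme core so that this file
  -- only needs `…StubTransferSymMain` (p121279) and `…StubNegReflectRP` (p120012)
  intro sch' ha hb hL hsym hpoly T hT
  obtain ⟨a', ha', hta', β', L', htL', c', m'⟩ := sch'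
  have ha1 : a' = sch.a := ha
  have hβ1 : β' = sch.β := hb
  have hL1 : L' = sch.L := hL
  subst ha1 hβ1 hL1
  exact Transfer.hasMassGap_of_slabClustering r hM (S := ⟨sch.a, ha', hta', sch.β, sch.L, htL', c', m'⟩)
    hshape hβ hvol (fun {b} hb' {Sh} hS F hF hFb {w} hw hdep => stub_negReflectRP r.ρ r.continuous hb' hS F hF hFb hw hdep)
    hclust hsym hpoly hT

/-- The repaired (B) is WEAKER than (B) as filed (a hypothesis was added; the `∀ sch'` clause was
restricted): nothing already proved toward the filed item is lost. -/
theorem latticeGapOnTrajectoryRV_of_filed (h : LatticeGapOnTrajectory) : LatticeGapOnTrajectoryRV := by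
  intro G _ _ _ _ hG r M θ sch n hM hθ hshape hβ _ htune
  obtain ⟨Δ, hΔ, hgap, htr⟩ := h G hG r M θ sch n hM hθ hshape hβ htune
  exact ⟨Δ, hΔ, hgap, fun sch' ha hb hL _ _ T hT => htr sch' ha hb hL T hT⟩

/-- **(S) repaired: `TunedSequenceExistsV`** — verbatim the filed `TunedSequenceExists` with the volume
clause added to the OUTPUT (free for the tuner, who chooses the torus half-sides `L_k`). -/
def TunedSequenceExistsV : Prop :=
  ∀ (G : Type) [Group G] [TopologicalSpace G] [IsTopologicalGroup G] [CompactSpace G],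
    IsCompactSimpleLieGroup G → letI : MeasurableSpace G := borel G; haveI : BorelSpace G := ⟨rfl⟩;
    ∀ (r : LatticeRep G) (M : ℕ), 2 ≤ M → ∃ θ₀ : ℝ, 0 < θ₀ ∧ ∀ θ : ℝ, 0 < θ → θ < θ₀ →
    ∃ (sch : SpeciesScheme (YMSpecies G)) (n : ℕ → ℕ), (∀ k, sch.a k = ((M : ℝ) ^ n k)⁻¹) ∧
      Filter.Tendsto sch.β Filter.atTop Filter.atTop ∧
      Filter.Tendsto (fun k => sch.a k * sch.L k / Real.log (sch.a k)⁻¹) Filter.atTop Filter.atTop ∧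
      (∀ t : ℕ, 0 < t → ∃ c : ℝ, Filter.Tendsto (fun k => ((M : ℝ) ^ n k) ^ 8 *
        latticeConnectedCorr r.ρ (sch.β k) (sch.side k) r.curvature.F r.curvature.F (t * M ^ n k))
        Filter.atTop (nhds c)) ∧
      Filter.Tendsto (fun k => ((M : ℝ) ^ n k) ^ 8 *
        latticeConnectedCorr r.ρ (sch.β k) (sch.side k) r.curvature.F r.curvature.F (M ^ n k))
        Filter.atTop (nhds θ)

/-- The repaired (S) is STRONGER than (S) as filed (one more output). -/
theorem tunedSequenceExists_of_V (h : TunedSequenceExistsV) : TunedSequenceExists := by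
  intro G _ _ _ _ hG r M hM
  obtain ⟨θ₀, hθ₀, hS⟩ := h G hG r M hM
  refine ⟨θ₀, hθ₀, fun θ hθ hθlt => ?_⟩
  obtain ⟨sch, n, hshape, hβ, -, hconv, htune⟩ := hS θ hθ hθlt
  exact ⟨sch, n, hshape, hβ, hconv, htune⟩

/-- **(A) repaired accordingly: `ContinuumLimitOnTrajectoryR`** (as in `Restatement.lean`): the produced
witness scheme `sch'` is ALSO reflection-symmetric and polynomially bounded (physically free). -/
def ContinuumLimitOnTrajectoryR : Prop :=
  ∀ (G : Type) [Group G] [TopologicalSpace G] [IsTopologicalGroup G] [CompactSpace G],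
    IsCompactSimpleLieGroup G → letI : MeasurableSpace G := borel G; haveI : BorelSpace G := ⟨rfl⟩;
    ∀ (r : LatticeRep G), ∃ M₀ : ℕ, ∀ M : ℕ, M₀ ≤ M → 2 ≤ M → ∃ θ₀ : ℝ, 0 < θ₀ ∧
    ∀ (θ Δ : ℝ) (sch : SpeciesScheme (YMSpecies G)) (n : ℕ → ℕ), 0 < θ → θ < θ₀ → 0 < Δ →
    (∀ k, sch.a k = ((M : ℝ) ^ n k)⁻¹) → Filter.Tendsto sch.β Filter.atTop Filter.atTop →
    (∀ t : ℕ, 0 < t → ∃ c : ℝ, Filter.Tendsto (fun k => ((M : ℝ) ^ n k) ^ 8 *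
      latticeConnectedCorr r.ρ (sch.β k) (sch.side k) r.curvature.F r.curvature.F (t * M ^ n k))
      Filter.atTop (nhds c)) →
    Filter.Tendsto (fun k => ((M : ℝ) ^ n k) ^ 8 *
      latticeConnectedCorr r.ρ (sch.β k) (sch.side k) r.curvature.F r.curvature.F (M ^ n k))
      Filter.atTop (nhds θ) →
    HasLatticeMassGap r sch Δ →
    ∃ sch' : SpeciesScheme (YMSpecies G), sch'.a = sch.a ∧ sch'.β = sch.β ∧ sch'.L = sch.L ∧
      sch'.IsReflectionSymmetric ∧
      (∀ s, ∃ (q : ℕ) (K : ℝ), ∀ k,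
        |sch'.c s k| ≤ K * ((sch'.a k)⁻¹) ^ q ∧ |sch'.m s k| ≤ K * ((sch'.a k)⁻¹) ^ q) ∧
      ∃ T : OSData (YMSpecies G) 4,
        IsYangMillsFor r sch' T ∧ T.IsNontrivial r.curvature ∧ T.IsNonGaussian r.curvature

/-- The repaired (A) is STRONGER than (A) as filed (it outputs more about `sch'`). -/
theorem continuumLimitOnTrajectory_of_R (h : ContinuumLimitOnTrajectoryR) :
    ContinuumLimitOnTrajectory := by
  intro G _ _ _ _ hG r
  obtain ⟨M₀, hM₀⟩ := h G hG r
  refine ⟨M₀, fun M hM hM2 => ?_⟩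
  obtain ⟨θ₀, hθ₀, hA⟩ := hM₀ M hM hM2
  refine ⟨θ₀, hθ₀, fun θ Δ sch n hθ hθlt hΔ hshape hβ hconv htune hgap => ?_⟩
  obtain ⟨sch', ha, hb, hL, -, -, T, hT, hNT, hNG⟩ :=
    hA θ Δ sch n hθ hθlt hΔ hshape hβ hconv htune hgap
  exact ⟨sch', ha, hb, hL, T, hT, hNT, hNG⟩

/-- **The deciding theorem, re-proved for the repaired items** (verbatim the route's `closes`, rev 7 with
the summit re-type `HasWeakCouplingLimit`; (S)'s volume output fed to (B)'s volume hypothesis, (A)'s two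
extra outputs fed to (B)'s restricted transfer clause). -/
theorem closesRV : ContinuumLimitOnTrajectoryR → LatticeGapOnTrajectoryRV → TunedSequenceExistsV →
    YangMills := by
  intro hA hB hS G _ _ _ _ hG
  obtain ⟨r⟩ := hG.2
  letI : MeasurableSpace G := borel G
  haveI : BorelSpace G := ⟨rfl⟩
  obtain ⟨M₀, hM₀⟩ := hA G hG r
  have hM2 : 2 ≤ max M₀ 2 := le_max_right _ _
  obtain ⟨θ₀, hθ₀, hA'⟩ := hM₀ (max M₀ 2) (le_max_left _ _) hM2
  obtain ⟨θ₁, hθ₁, hS'⟩ := hS G hG r (max M₀ 2) hM2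
  have hθpos : 0 < min θ₀ θ₁ / 2 := by positivity
  have hθlt₀ : min θ₀ θ₁ / 2 < θ₀ := by have := min_le_left θ₀ θ₁; linarith
  have hθlt₁ : min θ₀ θ₁ / 2 < θ₁ := by have := min_le_right θ₀ θ₁; linarith
  obtain ⟨sch, n, hshape, hbeta, hvol, hconv, htune⟩ := hS' (min θ₀ θ₁ / 2) hθpos hθlt₁
  obtain ⟨Δ, hΔ, hgap, htransfer⟩ :=
    hB G hG r (max M₀ 2) (min θ₀ θ₁ / 2) sch n hM2 hθpos hshape hbeta hvol htune
  obtain ⟨sch', ha, hβ, hL, hsym, hpoly, T, hYM, hNT, hNG⟩ :=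
    hA' (min θ₀ θ₁ / 2) Δ sch n hθpos hθlt₀ hΔ hshape hbeta hconv htune hgap
  have hweak : sch'.HasWeakCouplingLimit := by
    show Filter.Tendsto sch'.β Filter.atTop Filter.atTop
    rw [hβ]
    exact hbeta
  refine ⟨r, sch', T, hweak, hYM, hNT, hNG, Δ, hΔ, htransfer sch' ha hβ hL hsym hpoly T hYM, ?_⟩
  intro A B
  obtain ⟨C, hC⟩ := hgap A B
  refine ⟨C, ?_⟩
  simpa only [ha, hβ, hL] using hC

/-- With the pure-lattice (B): the same deciding theorem, the transfer now supplied by the tree. -/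
theorem closesUSC : ContinuumLimitOnTrajectoryR → LatticeGapOnTrajectoryUSC → TunedSequenceExistsV →
    YangMills := fun hA hB hS => closesRV hA (latticeGapOnTrajectoryRV_of_USC hB) hS

end Summit.QuantumFields.YangMills.Cruxes.LatticeGapOnTrajectory.RestatementC2
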